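import Literature.AlgebraicGeometry.AbelianSchemes.AbelianSchemePolarization
import Literature.AlgebraicGeometry.AbelianSchemes.AbelianSchemeQuotientMulNDescent
import Literature.AlgebraicGeometry.AbelianSchemes.AbelianSchemeOverMulNEtale
import Literature.AlgebraicGeometry.AbelianSchemes.AbelianSchemeOverMulNSurjective
import Mathlib.AlgebraicGeometry.Sites.Fpqc
import Mathlib.AlgebraicGeometry.Morphisms.Finite
import HarnessLib

/-!
# The quasi-inverse `μ : Â → A` of a polarisation: `λ ≫ μ = [e]`, `μ ≫ λ = [e]`, `μ` finite surjective (fpqc descent)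

Layer `Literature/AlgebraicGeometry/AbelianSchemes`, namespace `Literature.AlgebraicGeometry.AbelianSchemes.AbelianSchemeOver.Polarization`.
THEOREMS ONLY (no definition, no named fact, no instance, no `sorry`).

[MumfordAV1970] §7 Thm. 4 (p. 72) / remark after it («if `f : X → Y` is an isogeny with kernel killed by `n`, there is `g : Y → X`
with `g ∘ f = n_X`, `f ∘ g = n_Y`»), for the polarisation `λ : A → Â` of an abelian scheme over a base `S`, in the form that needs
NO biduality and NO quotient construction: if `λ` is flat, surjective and quasi-compact (an fpqc cover — Mathlib's
`EffectiveEpi` instance for such morphisms, `AlgebraicGeometry/Sites/Fpqc`) and `[e]_A` is constant on the fibres of `λ`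
(`hv`: `g₁ ≫ λ = g₂ ≫ λ ⟹ g₁ ≫ [e] = g₂ ≫ [e]` for all test pairs — the kernel of `λ` is killed by `e`), then `[e]_A` DESCENDS along
`λ` (Mathlib `EffectiveEpi.desc`):

* **`Polarization.exists_quasiInverse`** — `∃ μ : Â → A` over `S` with `λ ≫ μ = [e]_A`, `μ ≫ λ = [e]_Â` (cancel the epimorphism `λ`
  against `λ ≫ [e]_Â = [e]_A ≫ λ`), `μ` FINITE (`μ ≫ λ = [e]_Â` is finite, ★ `isFinite_pow_id_left`, and `λ` is separated — Mathlib
  `IsFinite.of_comp`) and SURJECTIVE (`λ ≫ μ = [e]_A` is surjective, ★ `surjective_pow_id_left`), for `e` invertible in the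
  residue fields of `S`;
* `Polarization.exists_quasiInverse_of_charZero` — the same over a base of characteristic `0` (`S → Spec K`, `CharZero K`, `e ≠ 0`).

Purpose (cell `hodgecm-mathlib`, D-0151; Hecke-link socket (B), (cov-3B) brick (B3), B-plan1 (g15) 23:31:31Z): `μ` finite
surjective `Â′ → A′` makes the abstract dual `Â′` of the Siegel family quasi-projective piece by piece (★
`isQuasiProjectiveOver_of_isFinite_of_surjective`), whence the stable affine cover `hcov′` of ★ `dualPairOfQuotientRigidified`.
The instance binders `[Flat] [Surjective] [QuasiCompact]` are (B1) (`PolarizationLamEtale`), `hv` is (B2) (`PolarizationKernelPairMulN`).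
Count-neutral; HC_CM is proved only modulo the 7 printed citations until rung 0 closes.

## References
* [MumfordAV1970] D. Mumford, *Abelian Varieties* (1970), §7 Thm. 4 (p. 72), §6 Application 2–3 (pp. 62–64).
* [GortzWedhorn2020] U. Görtz, T. Wedhorn, *Algebraic Geometry I*, 2nd ed. (2020), Thm. 14.72 and §(14.21) (fpqc descent of
  morphisms: a faithfully flat quasi-compact morphism is an effective epimorphism).
-/

set_option autoImplicit false

noncomputable section

universe u

open CategoryTheory CategoryTheory.Limits AlgebraicGeometry
-- NB: `MonObj` is NOT opened as a scope here: its notation `μ` would capture the bound name `μ` of the quasi-inverse.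

namespace Literature.AlgebraicGeometry.AbelianSchemes

namespace AbelianSchemeOver

namespace Polarization

variable {S : Scheme.{u}} {A : AbelianSchemeOver S} {D : A.DualPair} (pol : A.Polarization D)

/-- **THE QUASI-INVERSE OF A POLARISATION (fpqc descent of `[e]`)**: let `λ : A → Â` be flat, surjective and quasi-compact, let
`e` be invertible in the residue fields of `S`, and suppose `[e]_A` is constant on the fibres of `λ` (`hv`).  Then there is
`μ : Â → A` over `S` with `λ ≫ μ = [e]_A` and `μ ≫ λ = [e]_Â`, and `μ` is finite and surjective ([MumfordAV1970] §7 Thm. 4 and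
the remark following it; the descent is Mathlib's `EffectiveEpi.desc` for the fpqc cover `λ`, [GortzWedhorn2020] Thm. 14.72).
[cite: MumfordAV1970, §7 Thm. 4 (p. 72)] [cite: GortzWedhorn2020, Thm. 14.72] -/
theorem exists_quasiInverse [Flat pol.lam.left] [Surjective pol.lam.left] [QuasiCompact pol.lam.left] {e : ℕ}
    (he : ∀ s : S, (e : S.residueField s) ≠ 0)
    (hv : ∀ {Z : Scheme.{u}} (g₁ g₂ : Z ⟶ A.X.left), g₁ ≫ pol.lam.left = g₂ ≫ pol.lam.left →
      g₁ ≫ (A.mulN e).left = g₂ ≫ (A.mulN e).left) :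
    ∃ μ : D.hat.X ⟶ A.X, pol.lam ≫ μ = A.mulN e ∧ μ ≫ pol.lam = D.hat.mulN e ∧ IsFinite μ.left ∧ Surjective μ.left := by
  haveI := pol.isMonHom
  -- descend `[e]_A` along the fpqc cover `λ`
  obtain ⟨μl, hfac⟩ : ∃ μl : D.hat.X.left ⟶ A.X.left, pol.lam.left ≫ μl = (A.mulN e).left :=
    ⟨EffectiveEpi.desc pol.lam.left (A.mulN e).left hv, EffectiveEpi.fac _ _ _⟩
  haveI : Epi pol.lam.left := Flat.epi_of_flat_of_surjective _
  haveI : Epi pol.lam := Over.epi_of_epi_left _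
  -- `μ` lies over `S`
  have hw : μl ≫ A.X.hom = D.hat.X.hom := by
    rw [← cancel_epi pol.lam.left, ← Category.assoc, hfac, Over.w (A.mulN e), Over.w pol.lam]
  obtain ⟨μ, hμ⟩ : ∃ μ : D.hat.X ⟶ A.X, μ.left = μl := ⟨Over.homMk μl hw, rfl⟩
  have h1 : pol.lam ≫ μ = A.mulN e := Over.OverMorphism.ext (by rw [Over.comp_left, hμ, hfac])
  -- `μ ≫ λ = [e]_Â`: cancel `λ` against `λ ≫ [e]_Â = [e]_A ≫ λ`
  have h2 : μ ≫ pol.lam = D.hat.mulN e := by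
    rw [← cancel_epi pol.lam, ← Category.assoc, h1, mulN_def, mulN_def, MonObj.pow_comp, MonObj.comp_pow,
      Category.id_comp, Category.comp_id]
  refine ⟨μ, h1, h2, ?_, ?_⟩
  · -- finite: `μ ≫ λ = [e]_Â` is finite and `λ` is separated
    haveI : IsFinite (μ.left ≫ pol.lam.left) := by
      rw [← Over.comp_left, h2, mulN_def]
      exact D.hat.isFinite_pow_id_left he
    haveI : IsProper A.X.hom := A.isProper
    haveI : IsSeparated (pol.lam.left ≫ D.hat.X.hom) := by rw [Over.w pol.lam]; infer_instance
    haveI : IsSeparated pol.lam.left := IsSeparated.of_comp pol.lam.left D.hat.X.hom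
    exact IsFinite.of_comp μ.left pol.lam.left
  · -- surjective: `λ ≫ μ = [e]_A` is surjective
    haveI : Surjective (pol.lam.left ≫ μ.left) := by
      rw [← Over.comp_left, h1, mulN_def]
      exact A.surjective_pow_id_left he
    exact Surjective.of_comp pol.lam.left μ.left

/-- **The quasi-inverse over a base of characteristic zero**: for `S → Spec K` with `CharZero K` and `e ≠ 0`, the hypothesis «`e`
invertible in the residue fields» of `exists_quasiInverse` is automatic. [cite: MumfordAV1970, §7 Thm. 4 (p. 72)] -/
theorem exists_quasiInverse_of_charZero {K : Type u} [Field K] [CharZero K] (f : S ⟶ Spec (.of K)) [Flat pol.lam.left]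
    [Surjective pol.lam.left] [QuasiCompact pol.lam.left] {e : ℕ} (he : e ≠ 0)
    (hv : ∀ {Z : Scheme.{u}} (g₁ g₂ : Z ⟶ A.X.left), g₁ ≫ pol.lam.left = g₂ ≫ pol.lam.left →
      g₁ ≫ (A.mulN e).left = g₂ ≫ (A.mulN e).left) :
    ∃ μ : D.hat.X ⟶ A.X, pol.lam ≫ μ = A.mulN e ∧ μ ≫ pol.lam = D.hat.mulN e ∧ IsFinite μ.left ∧ Surjective μ.left := by
  refine pol.exists_quasiInverse (fun s => ?_) hv
  let φ : K →+* S.residueField s := (Spec.preimage (S.fromSpecResidueField s ≫ f)).hom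
  rw [← map_natCast φ e]
  exact (map_ne_zero φ).mpr (Nat.cast_ne_zero.mpr he)

end Polarization

end AbelianSchemeOver

end Literature.AlgebraicGeometry.AbelianSchemes

end
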